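import Literature.NumberTheory.LFunctions.KloostermanFractionsOptimiseL
import HarnessLib

/-!
# Bilinear forms with Kloosterman fractions: the choice of `L` for the `O`-family

Topic `NumberTheory/LFunctions`.  S. Bettin, V. Chandee, *Trilinear forms with Kloosterman
fractions*, Adv. Math. 328 (2018), §5 "Optimizing the parameter `L`", replayed for the four-term
family `M²/L + b^{1/2}MN'L^{-1/2} + b^{1/2}LN'^{3/2} + b^{1/2}L^{3/2}N'^{7/4}` which the explicit
off-diagonal bound `kfO_le` of the tree (`KloostermanFractionsOffDiagO.lean`) produces in place of
Bettin–Chandee's (5.1) (`KloostermanFractionsFromOffO.lean`).  With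
`L = M^{4/5}b^{-1/5}N^{-7/10} + M^{1/2}N^{-3/8} + X` (`X ≥ 1` free) each term is dominated by one of
`b^{1/5}M^{6/5}N^{7/10}, b^{1/2}M^{3/4}N^{19/16}, b^{3/10}M^{4/5}N^{4/5}, b^{1/2}M^{1/2}N^{9/8},
b^{1/2}N^{7/4}, b^{1/2}N^{3/2}` times `9X^{3/2}` (`BC_optimise_LO`).  Pure real-variable
bookkeeping in logarithmic coordinates, as `BC_optimise_L`.

## References

* S. Bettin, V. Chandee, Adv. Math. 328 (2018) 1234–1262 (arXiv:1502.00769), §5.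
  [BettinChandee2018]
-/

noncomputable section

open Finset

namespace Literature.NumberTheory.LFunctions

set_option maxHeartbeats 400000 in
/-- **The choice of `L` for the `O`-family.**  For `M, N, b > 0`, `X ≥ 1` and
`L = M^{4/5}b^{-1/5}N^{-7/10} + M^{1/2}N^{-3/8} + X`,
`M²/L + b^{1/2}MNL^{-1/2} + b^{1/2}LN^{3/2} + b^{1/2}L^{3/2}N^{7/4} ≤ 9X^{3/2}(b^{1/5}M^{6/5}N^{7/10} +
b^{1/2}M^{3/4}N^{19/16} + b^{3/10}M^{4/5}N^{4/5} + b^{1/2}M^{1/2}N^{9/8} + b^{1/2}N^{7/4} + b^{1/2}N^{3/2})`.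
[cite: BettinChandee2018, §5] -/
theorem BC_optimise_LO {M N b X L : ℝ} (hM : 0 < M) (hN : 0 < N) (hb : 0 < b) (hX : 1 ≤ X)
    (hL : L = M ^ (4 / 5 : ℝ) * b ^ (-(1 / 5) : ℝ) * N ^ (-(7 / 10) : ℝ) +
      M ^ (1 / 2 : ℝ) * N ^ (-(3 / 8) : ℝ) + X) :
    M ^ 2 / L + b ^ (1 / 2 : ℝ) * M * N * L ^ (-(1 / 2) : ℝ) + b ^ (1 / 2 : ℝ) * L * N ^ (3 / 2 : ℝ) +
        b ^ (1 / 2 : ℝ) * L ^ (3 / 2 : ℝ) * N ^ (7 / 4 : ℝ) ≤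
      9 * X ^ (3 / 2 : ℝ) * (b ^ (1 / 5 : ℝ) * M ^ (6 / 5 : ℝ) * N ^ (7 / 10 : ℝ) +
        b ^ (1 / 2 : ℝ) * M ^ (3 / 4 : ℝ) * N ^ (19 / 16 : ℝ) +
        b ^ (3 / 10 : ℝ) * M ^ (4 / 5 : ℝ) * N ^ (4 / 5 : ℝ) +
        b ^ (1 / 2 : ℝ) * M ^ (1 / 2 : ℝ) * N ^ (9 / 8 : ℝ) +
        b ^ (1 / 2 : ℝ) * N ^ (7 / 4 : ℝ) + b ^ (1 / 2 : ℝ) * N ^ (3 / 2 : ℝ)) := by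
  have hX0 : 0 < X := by linarith
  -- logarithmic coordinates
  obtain ⟨m, hm⟩ : ∃ m : ℝ, m = Real.log M := ⟨_, rfl⟩
  obtain ⟨n, hn⟩ : ∃ n : ℝ, n = Real.log N := ⟨_, rfl⟩
  obtain ⟨l, hl⟩ : ∃ l : ℝ, l = Real.log b := ⟨_, rfl⟩
  have eM : ∀ c : ℝ, M ^ c = Real.exp (c * m) := fun c => by rw [Real.rpow_def_of_pos hM, mul_comm, hm]
  have eN : ∀ c : ℝ, N ^ c = Real.exp (c * n) := fun c => by rw [Real.rpow_def_of_pos hN, mul_comm, hn]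
  have eb : ∀ c : ℝ, b ^ c = Real.exp (c * l) := fun c => by rw [Real.rpow_def_of_pos hb, mul_comm, hl]
  have eM1 : M = Real.exp m := by rw [hm, Real.exp_log hM]
  have eN1 : N = Real.exp n := by rw [hn, Real.exp_log hN]
  have eM2 : M ^ 2 = Real.exp (2 * m) := by
    rw [eM1, ← Real.exp_nat_mul]; norm_num
  -- the summands of `L`
  obtain ⟨t₁, ht₁⟩ : ∃ t : ℝ, t = Real.exp (4 / 5 * m + -(1 / 5) * l + -(7 / 10) * n) := ⟨_, rfl⟩
  obtain ⟨t₂, ht₂⟩ : ∃ t : ℝ, t = Real.exp (1 / 2 * m + -(3 / 8) * n) := ⟨_, rfl⟩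
  have ht₁' : M ^ (4 / 5 : ℝ) * b ^ (-(1 / 5) : ℝ) * N ^ (-(7 / 10) : ℝ) = t₁ := by
    rw [ht₁, eM, eb, eN, ← Real.exp_add, ← Real.exp_add]
  have ht₂' : M ^ (1 / 2 : ℝ) * N ^ (-(3 / 8) : ℝ) = t₂ := by
    rw [ht₂, eM, eN, ← Real.exp_add]
  have ht₁0 : 0 < t₁ := by rw [ht₁]; exact Real.exp_pos _
  have ht₂0 : 0 < t₂ := by rw [ht₂]; exact Real.exp_pos _
  rw [ht₁', ht₂'] at hL
  have hL1 : t₁ ≤ L := by rw [hL]; linarith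
  have hL2 : t₂ ≤ L := by rw [hL]; linarith
  have hLX : X ≤ L := by rw [hL]; linarith
  have hL0 : 0 < L := by linarith
  have hLge1 : 1 ≤ L := hX.trans hLX
  -- the six right-hand terms
  obtain ⟨R₁, hR₁⟩ : ∃ t : ℝ, t = Real.exp (1 / 5 * l + 6 / 5 * m + 7 / 10 * n) := ⟨_, rfl⟩
  obtain ⟨R₂, hR₂⟩ : ∃ t : ℝ, t = Real.exp (1 / 2 * l + 3 / 4 * m + 19 / 16 * n) := ⟨_, rfl⟩
  obtain ⟨R₃, hR₃⟩ : ∃ t : ℝ, t = Real.exp (3 / 10 * l + 4 / 5 * m + 4 / 5 * n) := ⟨_, rfl⟩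
  obtain ⟨R₄, hR₄⟩ : ∃ t : ℝ, t = Real.exp (1 / 2 * l + 1 / 2 * m + 9 / 8 * n) := ⟨_, rfl⟩
  obtain ⟨R₅, hR₅⟩ : ∃ t : ℝ, t = Real.exp (1 / 2 * l + 7 / 4 * n) := ⟨_, rfl⟩
  obtain ⟨R₆, hR₆⟩ : ∃ t : ℝ, t = Real.exp (1 / 2 * l + 3 / 2 * n) := ⟨_, rfl⟩
  have hR₁' : b ^ (1 / 5 : ℝ) * M ^ (6 / 5 : ℝ) * N ^ (7 / 10 : ℝ) = R₁ := by
    rw [hR₁, eb, eM, eN, ← Real.exp_add, ← Real.exp_add]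
  have hR₂' : b ^ (1 / 2 : ℝ) * M ^ (3 / 4 : ℝ) * N ^ (19 / 16 : ℝ) = R₂ := by
    rw [hR₂, eb, eM, eN, ← Real.exp_add, ← Real.exp_add]
  have hR₃' : b ^ (3 / 10 : ℝ) * M ^ (4 / 5 : ℝ) * N ^ (4 / 5 : ℝ) = R₃ := by
    rw [hR₃, eb, eM, eN, ← Real.exp_add, ← Real.exp_add]
  have hR₄' : b ^ (1 / 2 : ℝ) * M ^ (1 / 2 : ℝ) * N ^ (9 / 8 : ℝ) = R₄ := by
    rw [hR₄, eb, eM, eN, ← Real.exp_add, ← Real.exp_add]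
  have hR₅' : b ^ (1 / 2 : ℝ) * N ^ (7 / 4 : ℝ) = R₅ := by
    rw [hR₅, eb, eN, ← Real.exp_add]
  have hR₆' : b ^ (1 / 2 : ℝ) * N ^ (3 / 2 : ℝ) = R₆ := by
    rw [hR₆, eb, eN, ← Real.exp_add]
  rw [hR₁', hR₂', hR₃', hR₄', hR₅', hR₆']
  have hR₁0 : 0 < R₁ := by rw [hR₁]; exact Real.exp_pos _
  have hR₂0 : 0 < R₂ := by rw [hR₂]; exact Real.exp_pos _
  have hR₃0 : 0 < R₃ := by rw [hR₃]; exact Real.exp_pos _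
  have hR₄0 : 0 < R₄ := by rw [hR₄]; exact Real.exp_pos _
  have hR₅0 : 0 < R₅ := by rw [hR₅]; exact Real.exp_pos _
  have hR₆0 : 0 < R₆ := by rw [hR₆]; exact Real.exp_pos _
  have hX32 : 1 ≤ X ^ (3 / 2 : ℝ) := Real.one_le_rpow hX (by norm_num)
  have hXX : X ≤ X ^ (3 / 2 : ℝ) := by
    calc X = X ^ (1 : ℝ) := (Real.rpow_one X).symm
      _ ≤ X ^ (3 / 2 : ℝ) := Real.rpow_le_rpow_of_exponent_le hX (by norm_num)
  have hb12 : b ^ (1 / 2 : ℝ) = Real.exp (1 / 2 * l) := eb _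
  -- (1) `M²/L ≤ M²/t₁ = R₁`
  have b1 : M ^ 2 / L ≤ R₁ := by
    have h1 : M ^ 2 / L ≤ M ^ 2 / t₁ := div_le_div_of_nonneg_left (by positivity) ht₁0 hL1
    have h2 : M ^ 2 / t₁ = R₁ := by
      rw [div_eq_iff ht₁0.ne', eM2, ht₁, hR₁, ← Real.exp_add]
      congr 1; ring
    exact h1.trans h2.le
  -- (2) `b^{1/2} M N L^{-1/2} ≤ b^{1/2} M N t₂^{-1/2} = R₂`
  have b2 : b ^ (1 / 2 : ℝ) * M * N * L ^ (-(1 / 2) : ℝ) ≤ R₂ := by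
    have h1 : L ^ (-(1 / 2) : ℝ) ≤ t₂ ^ (-(1 / 2) : ℝ) :=
      Real.rpow_le_rpow_of_nonpos ht₂0 hL2 (by norm_num)
    have h2 : b ^ (1 / 2 : ℝ) * M * N * t₂ ^ (-(1 / 2) : ℝ) = R₂ := by
      rw [hb12, eM1, eN1, ht₂, ← Real.exp_mul, hR₂, ← Real.exp_add, ← Real.exp_add, ← Real.exp_add]
      congr 1; ring
    calc b ^ (1 / 2 : ℝ) * M * N * L ^ (-(1 / 2) : ℝ) ≤ b ^ (1 / 2 : ℝ) * M * N * t₂ ^ (-(1 / 2) : ℝ) :=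
          mul_le_mul_of_nonneg_left h1 (by positivity)
      _ = R₂ := h2
  -- (3) `b^{1/2} L N^{3/2} = R₆ (t₁ + t₂ + X) = R₃ + R₄ + X R₆`
  have b3 : b ^ (1 / 2 : ℝ) * L * N ^ (3 / 2 : ℝ) = R₃ + R₄ + X * R₆ := by
    have i1 : R₆ * t₁ = R₃ := by
      rw [hR₆, ht₁, hR₃, ← Real.exp_add]; congr 1; ring
    have i2 : R₆ * t₂ = R₄ := by
      rw [hR₆, ht₂, hR₄, ← Real.exp_add]; congr 1; ring
    have e : b ^ (1 / 2 : ℝ) * N ^ (3 / 2 : ℝ) = R₆ := hR₆'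
    calc b ^ (1 / 2 : ℝ) * L * N ^ (3 / 2 : ℝ) = (b ^ (1 / 2 : ℝ) * N ^ (3 / 2 : ℝ)) * L := by ring
      _ = R₆ * (t₁ + t₂ + X) := by rw [e, hL]
      _ = R₆ * t₁ + R₆ * t₂ + X * R₆ := by ring
      _ = R₃ + R₄ + X * R₆ := by rw [i1, i2]
  -- (4) `b^{1/2} L^{3/2} N^{7/4} = R₅ L^{3/2} ≤ 6 (R₁ + R₂ + X^{3/2} R₅)`
  have b4 : b ^ (1 / 2 : ℝ) * L ^ (3 / 2 : ℝ) * N ^ (7 / 4 : ℝ) ≤ 6 * (R₁ + R₂ + X ^ (3 / 2 : ℝ) * R₅) := by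
    obtain ⟨tm, htm⟩ : ∃ t : ℝ, t = max (max t₁ t₂) X := ⟨_, rfl⟩
    have e1 : t₁ ≤ tm := by rw [htm]; exact (le_max_left t₁ t₂).trans (le_max_left _ _)
    have e2 : t₂ ≤ tm := by rw [htm]; exact (le_max_right t₁ t₂).trans (le_max_left _ _)
    have e4 : X ≤ tm := by rw [htm]; exact le_max_right _ _
    have htm0 : 0 ≤ tm := hX0.le.trans e4
    have hLtm : L ≤ 3 * tm := by rw [hL]; linarith
    have h332 : (3 : ℝ) ^ (3 / 2 : ℝ) ≤ 6 := by
      have h1 : (3 : ℝ) ^ (3 / 2 : ℝ) = 3 * (3 : ℝ) ^ (1 / 2 : ℝ) := by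
        rw [show (3 / 2 : ℝ) = 1 + 1 / 2 by norm_num, Real.rpow_add (by norm_num), Real.rpow_one]
      have h2 : (3 : ℝ) ^ (1 / 2 : ℝ) ≤ 2 := by
        calc (3 : ℝ) ^ (1 / 2 : ℝ) ≤ 4 ^ (1 / 2 : ℝ) := Real.rpow_le_rpow (by norm_num) (by norm_num) (by norm_num)
          _ = 2 := by
              rw [show (4 : ℝ) = 2 ^ (2 : ℝ) by norm_num, ← Real.rpow_mul (by norm_num)]
              norm_num
      rw [h1]; linarith
    have hL32 : L ^ (3 / 2 : ℝ) ≤ 6 * (t₁ ^ (3 / 2 : ℝ) + t₂ ^ (3 / 2 : ℝ) + X ^ (3 / 2 : ℝ)) := by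
      have h1 : L ^ (3 / 2 : ℝ) ≤ (3 * tm) ^ (3 / 2 : ℝ) := Real.rpow_le_rpow hL0.le hLtm (by norm_num)
      have h2 : (3 * tm) ^ (3 / 2 : ℝ) ≤ 6 * tm ^ (3 / 2 : ℝ) := by
        rw [Real.mul_rpow (by norm_num) htm0]
        exact mul_le_mul_of_nonneg_right h332 (by positivity)
      have h3 : tm ^ (3 / 2 : ℝ) ≤ t₁ ^ (3 / 2 : ℝ) + t₂ ^ (3 / 2 : ℝ) + X ^ (3 / 2 : ℝ) := by
        rw [htm]
        calc (max (max t₁ t₂) X) ^ (3 / 2 : ℝ) ≤ (max t₁ t₂) ^ (3 / 2 : ℝ) + X ^ (3 / 2 : ℝ) :=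
              DFI_max_rpow_le_add _ (le_max_of_le_left ht₁0.le) hX0.le
          _ ≤ (t₁ ^ (3 / 2 : ℝ) + t₂ ^ (3 / 2 : ℝ)) + X ^ (3 / 2 : ℝ) := by
              have := DFI_max_rpow_le_add (3 / 2 : ℝ) ht₁0.le ht₂0.le
              linarith
      have h60 : 0 ≤ t₁ ^ (3 / 2 : ℝ) + t₂ ^ (3 / 2 : ℝ) + X ^ (3 / 2 : ℝ) := by positivity
      calc L ^ (3 / 2 : ℝ) ≤ 6 * tm ^ (3 / 2 : ℝ) := h1.trans h2
        _ ≤ _ := by linarith [h3]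
    have i1 : R₅ * t₁ ^ (3 / 2 : ℝ) = R₁ := by
      rw [ht₁, ← Real.exp_mul, hR₅, hR₁, ← Real.exp_add]; congr 1; ring
    have i2 : R₅ * t₂ ^ (3 / 2 : ℝ) = R₂ := by
      rw [ht₂, ← Real.exp_mul, hR₅, hR₂, ← Real.exp_add]; congr 1; ring
    have hbN : b ^ (1 / 2 : ℝ) * N ^ (7 / 4 : ℝ) = R₅ := hR₅'
    calc b ^ (1 / 2 : ℝ) * L ^ (3 / 2 : ℝ) * N ^ (7 / 4 : ℝ)
        = (b ^ (1 / 2 : ℝ) * N ^ (7 / 4 : ℝ)) * L ^ (3 / 2 : ℝ) := by ring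
      _ = R₅ * L ^ (3 / 2 : ℝ) := by rw [hbN]
      _ ≤ R₅ * (6 * (t₁ ^ (3 / 2 : ℝ) + t₂ ^ (3 / 2 : ℝ) + X ^ (3 / 2 : ℝ))) :=
          mul_le_mul_of_nonneg_left hL32 hR₅0.le
      _ = 6 * (R₅ * t₁ ^ (3 / 2 : ℝ) + R₅ * t₂ ^ (3 / 2 : ℝ) + X ^ (3 / 2 : ℝ) * R₅) := by ring
      _ = 6 * (R₁ + R₂ + X ^ (3 / 2 : ℝ) * R₅) := by rw [i1, i2]
  -- assemble
  have g : ∀ {R : ℝ}, 0 ≤ R → R ≤ X ^ (3 / 2 : ℝ) * R := fun hR => le_mul_of_one_le_left hR hX32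
  have g1 := g hR₁0.le; have g2 := g hR₂0.le; have g3 := g hR₃0.le
  have g4 := g hR₄0.le; have g5 := g hR₅0.le; have g6 := g hR₆0.le
  have hX320 : 0 ≤ X ^ (3 / 2 : ℝ) := Real.rpow_nonneg hX0.le _
  have p5 : 0 ≤ X ^ (3 / 2 : ℝ) * R₅ := mul_nonneg hX320 hR₅0.le
  have p6 : X * R₆ ≤ X ^ (3 / 2 : ℝ) * R₆ := mul_le_mul_of_nonneg_right hXX hR₆0.le
  have p1 : 0 ≤ X ^ (3 / 2 : ℝ) * R₁ := mul_nonneg hX320 hR₁0.le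
  have p2 : 0 ≤ X ^ (3 / 2 : ℝ) * R₂ := mul_nonneg hX320 hR₂0.le
  have p3 : 0 ≤ X ^ (3 / 2 : ℝ) * R₃ := mul_nonneg hX320 hR₃0.le
  have p4 : 0 ≤ X ^ (3 / 2 : ℝ) * R₄ := mul_nonneg hX320 hR₄0.le
  have p6' : 0 ≤ X ^ (3 / 2 : ℝ) * R₆ := mul_nonneg hX320 hR₆0.le
  rw [b3]
  calc M ^ 2 / L + b ^ (1 / 2 : ℝ) * M * N * L ^ (-(1 / 2) : ℝ) + (R₃ + R₄ + X * R₆) +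
        b ^ (1 / 2 : ℝ) * L ^ (3 / 2 : ℝ) * N ^ (7 / 4 : ℝ)
      ≤ R₁ + R₂ + (R₃ + R₄ + X * R₆) + 6 * (R₁ + R₂ + X ^ (3 / 2 : ℝ) * R₅) := by
        linarith only [b1, b2, b4]
    _ ≤ 9 * X ^ (3 / 2 : ℝ) * (R₁ + R₂ + R₃ + R₄ + R₅ + R₆) := by
        linarith only [g1, g2, g3, g4, g5, g6, p1, p2, p3, p4, p5, p6, p6']

end Literature.NumberTheory.LFunctions

end
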